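import Mathlib
import Literature.NumberTheory.EllipticCurves.HeegnerPoints
import HarnessLib

/-!
# Line sketch `gross-pairing-at-two` (crux `SignedMuSeedAtTwoPlus`, stmt-BirchSwinnertonDyer-21438; crux-ideate r1 k1 g32) — NOT a registered skeleton (W-79)

First checkable statements of the line «the local square class of the ρ̄-elliptic unit at the universal
supersingular prime 2 is a Gross pairing».  Nothing here asserts the crux, (F), LNS or BSD.

* `GaussVenkovAtTwo` — the first rung of the dictionary «ideal classes of `K = ℚ(√D)`, `D ≡ 5 (mod 8)` ↔
  Gross points of `K` on the Hurwitz supersingular point ↔ odd representations `|D| = a² + b² + c²`»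
  (Gauss, Disq. Arith. art. 291; Venkov 1931 via Hurwitz quaternions; Voight, Quaternion algebras §30.2):
  `r₃(|D|) = 24·h(D)` for fundamental `D ≡ 5 (mod 8)`, `D < -3`.  Known theorem, not in Mathlib (port, size L).
* `sum_nsmul_eq_sum_mod_two_add_two_nsmul` — the bookkeeping behind «square class of a product over the CM
  torsor = parity vector of the fibres paired with the local test vector» (proved).
-/

set_option linter.dupNamespace false

namespace Summit.BirchSwinnertonDyer.BirchSwinnertonDyer.Cruxes.SignedMuSeedAtTwoPlus.GrossPairing

open Literature.NumberTheory.EllipticCurves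

/-- Gauss–Venkov at the prime `2`: for an imaginary quadratic field `K` of discriminant `D ≡ 5 (mod 8)`,
`D < -3` (so `2` is inert and `𝒪_Kˣ = {±1}`), the number of `v ∈ ℤ³` with `v₁² + v₂² + v₃² = |D|` is
`24 · h(K)` — equivalently, the optimal embeddings `𝒪_K ↪ 𝒪` into the Hurwitz order (= `End` of the
supersingular curve `y² + y = x³` over `𝔽̄₂`) modulo `𝒪ˣ = SL₂(𝔽₃)` are a torsor-image of `Cl(K)` of the
size predicted by Eichler's formula. -/
def GaussVenkovAtTwo : Prop :=
  ∀ (K : Type) [Field K] [NumberField K], IsImaginaryQuadratic K →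
    NumberField.discr K % 8 = 5 → NumberField.discr K < -3 →
      Nat.card {v : Fin 3 → ℤ // ∑ i, v i ^ 2 = - NumberField.discr K} = 24 * NumberField.classNumber K

/-- Parity bookkeeping: a product over the CM torsor of local factors, read in a group where only classes
modulo `2` matter, depends on the fibre counts `N` only through `N mod 2`. -/
theorem sum_nsmul_eq_sum_mod_two_add_two_nsmul {X V : Type*} [Fintype X] [AddCommMonoid V]
    (F : X → V) (N : X → ℕ) :
    ∑ x, N x • F x = ∑ x, (N x % 2) • F x + 2 • ∑ x, (N x / 2) • F x := by
  have h : ∀ x, N x • F x = (N x % 2) • F x + 2 • ((N x / 2) • F x) := by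
    intro x
    rw [← mul_smul, ← add_smul, Nat.mod_add_div]
  simp_rw [h, Finset.sum_add_distrib, Finset.smul_sum]

/-- In an `𝔽₂`-vector space (e.g. `U′^χ_m / 2U′^χ_m`) the `2 •` term dies: the class of the product is the
PARITY PAIRING `Σ_ξ (N ξ mod 2) • F ξ`. -/
theorem sum_nsmul_eq_sum_mod_two_of_two_nsmul_eq_zero {X V : Type*} [Fintype X] [AddCommMonoid V]
    (h2 : ∀ v : V, 2 • v = 0) (F : X → V) (N : X → ℕ) :
    ∑ x, N x • F x = ∑ x, (N x % 2) • F x := by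
  rw [sum_nsmul_eq_sum_mod_two_add_two_nsmul, h2, add_zero]

end Summit.BirchSwinnertonDyer.BirchSwinnertonDyer.Cruxes.SignedMuSeedAtTwoPlus.GrossPairing
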